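import Mathlib
import HarnessLib
import Summits.CriticalPhenomena.CardyFormulaZ2.Theses.CardyBoundaryCoulombGas

/-!
# Sketch (ideator 1, round 1) — first lemmas for the crux `HalfPlaneMarkDensityLaw` (stmt-CriticalPhenomena-5661)

Two crux ideas:
* `shift-delocalisation`: lattice translation along ∂(ℤ×ℕ) turns the site-dependence of the touch
  probability into mark-dependence (exact identity `ShiftIdentity`), window sums telescope to crossing
  probabilities (`WindowTelescoping`), RSW gives ratio-equicontinuity (`ShiftRatioEquicontinuity`), hence
  the pointwise density law follows from the WINDOW law `HalfPlaneCardyWindow` (C⁺) — `WindowToPointwise`;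
  and C⁺ follows from the sibling crux `RectilinearCardy` by box exhaustion (`BoxExhaustion`).
* `touch-factorisation`: an amplitude-free Kleban–Simmons–Ziff-type factorisation of the cube of the
  touch probability through the extreme-touch two-point function `T2` (`FactorisedTouchRatio`) plus the
  two-point touch law at the KNOWN exponent 2 = 2β₂⁺ (`TwoPointTouchLaw`) give the pure-product SHAPE
  (`ShapeFromFactorisation`, pure algebra of limits), and the constant is forced by normalisation
  (`ConstantForced`); composition `line_of`.
Nothing here is proved except trivial compositions; every `def … : Prop` is a statement to be proved later.
-/

namespace Summit.CriticalPhenomena.CardyFormulaZ2.Cruxes.HalfPlaneMarkDensityLaw.SketchIdeator1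

open Literature.Probability.Percolation Literature.Probability.LatticeModels
open Literature.Probability.RandomPlanarGeometry
open Summit.CriticalPhenomena.CardyFormulaZ2.Theses.CardyBoundaryCoulombGas
open Filter MeasureTheory
open scoped BigOperators

noncomputable section

/-- `P_{1/2}` for bond percolation on `ℤ²`. -/
abbrev P : Measure (BondConfig (Site 2)) := bondPercolation (zdGraph 2) half

/-- The closed upper half-plane `ℤ × ℕ`. -/
abbrev UHP : Set (Site 2) := {v | 0 ≤ v 1}

/-- The boundary segment `[A, B] × {0}`. -/
def bseg (A B : ℤ) : Set (Site 2) := {v | v 1 = 0 ∧ A ≤ v 0 ∧ v 0 ≤ B}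

/-- The half-open boundary segment `[C, k) × {0}`. -/
def bsegR (C k : ℤ) : Set (Site 2) := {v | v 1 = 0 ∧ C ≤ v 0 ∧ v 0 < k}

/-- The touch event: `(k,0)` is joined inside `ℤ×ℕ` to `[A,B]×{0}` and no vertex of `[C,k)×{0}` is
(planarity: = one open arm `k → [A,B]` and one closed dual arm from the boundary dual edge `k-½` to a
boundary dual edge `j+½`, `B ≤ j < C`). For `k ≥ C` it says: `k` is the leftmost vertex of `[C,∞)` in
the open cluster(s) of `[A,B]`. -/
def touchEvent (A B C k : ℤ) : Set (BondConfig (Site 2)) :=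
  openCrossing UHP (bseg A B) {![k, 0]} \ openCrossing UHP (bseg A B) (bsegR C k)

/-- The touch probability `P_{1/2}(touchEvent A B C k)`. -/
def touchProb (A B C k : ℤ) : ℝ := P.real (touchEvent A B C k)

/-- Cardy's touch density `ρ(x; a,b,c) = F'(η)∂ₓη` (the crux's limit). -/
def rho (a b c x : ℝ) : ℝ :=
  cardyConst / 3 * ((b - a) * (c - b) * (c - a)) ^ (1 / 3 : ℝ) * ((x - a) * (x - b) * (x - c)) ^ (-(2 / 3) : ℝ)

/-- The crux, restated through `touchProb` (definitionally the route decl). -/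
def CruxRestated : Prop :=
  ∀ a b c x : ℝ, a < b → b < c → c < x →
    Tendsto (fun n : ℕ ↦ (n : ℝ) * touchProb ⌊a * n⌋ ⌊b * n⌋ ⌊c * n⌋ ⌊x * n⌋) atTop (nhds (rho a b c x))

theorem cruxRestated_iff : CruxRestated ↔ HalfPlaneMarkDensityLaw := Iff.rfl

/-! ## Card `shift-delocalisation` -/

/-- EXACT lattice identity (translation of `ℤ×ℕ` by `(j,0)` is a graph automorphism preserving
`P_{1/2}`): shifting the touch site is shifting the three marks. Provable now. -/
def ShiftIdentity : Prop :=
  ∀ A B C k j : ℤ, touchProb A B C (k + j) = touchProb (A - j) (B - j) (C - j) k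

/-- EXACT telescoping: window sums of touch probabilities are differences of crossing probabilities
(the events `touchEvent A B C (k+i)`, `i < m`, are disjoint and their union is
`{[A,B] ↔ [C,k+m)} \ {[A,B] ↔ [C,k)}`). Provable now. -/
def WindowTelescoping : Prop :=
  ∀ A B C k : ℤ, ∀ m : ℕ, B < C → C ≤ k →
    ∑ i ∈ Finset.range m, touchProb A B C (k + i) =
      P.real (openCrossing UHP (bseg A B) (bsegR C (k + m))) -
        P.real (openCrossing UHP (bseg A B) (bsegR C k))

/-- RSW-only ratio equicontinuity under boundary shifts: moving the touch site by `j ≤ δn` changes the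
touch probability by a RELATIVE error `ε` (via `ShiftIdentity`: moving the three marks by `≤ δn`
changes the event only through boundary arm events near the arc ends, of relative cost
`≤ C(a,b,c,x) (δ/δ')^λ`, `λ > 0`, by RSW in dyadic half-annuli, independence of disjoint regions and
the RSW/FKG gluing lower bound for the touch event). Provable now from `rsw_half`, Harris–FKG,
planarity. -/
def ShiftRatioEquicontinuity : Prop :=
  ∀ a b c x : ℝ, a < b → b < c → c < x → ∀ ε : ℝ, 0 < ε → ∃ δ : ℝ, 0 < δ ∧ ∀ᶠ n : ℕ in atTop,
    ∀ j : ℕ, (j : ℝ) ≤ δ * n →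
      |touchProb ⌊a * n⌋ ⌊b * n⌋ ⌊c * n⌋ (⌊x * n⌋ + j) - touchProb ⌊a * n⌋ ⌊b * n⌋ ⌊c * n⌋ ⌊x * n⌋|
        ≤ ε * touchProb ⌊a * n⌋ ⌊b * n⌋ ⌊c * n⌋ ⌊x * n⌋

/-- C⁺ (the TRANSFER target): window / integrated half-plane Cardy formula for bond-`ℤ²` with four
collinear marks `a < b < c < X` on `∂ℍ`: `P_{1/2}[[an,bn] ↔_{ℤ×ℕ} [cn,Xn]] → F(η(a,b,c,X))`. -/
def HalfPlaneCardyWindow : Prop :=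
  ∀ a b c X : ℝ, a < b → b < c → c < X →
    Tendsto (fun n : ℕ ↦ P.real (openCrossing UHP (bseg ⌊a * n⌋ ⌊b * n⌋) (bseg ⌊c * n⌋ ⌊X * n⌋)))
      atTop (nhds (cardyFunction (crossRatio ![a, b, c, X])))

/-- The de-localisation lemma the card bets on: window law + ratio equicontinuity ⇒ the crux
(plus the calculus fact `d/dX F(η(a,b,c,X)) = rho a b c X`, i.e. `hasDerivAt_cardyFunction` + chain
rule, the derivative half of the support item `PureProductIntegrates`). -/
def WindowToPointwise : Prop :=
  HalfPlaneCardyWindow → ShiftRatioEquicontinuity → HalfPlaneMarkDensityLaw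

/-- Box exhaustion (RSW): Cardy for axis-parallel rectangles `[-Ln,Ln]×[0,Ln]` with the four marks on
the bottom side, `L → ∞`, gives the half-plane window law; so C⁺ — hence, by `WindowToPointwise`, the
crux — closes with the sibling crux `RectilinearCardy`. -/
def BoxExhaustion : Prop := RectilinearCardy → HalfPlaneCardyWindow

/-! ## Card `touch-factorisation` -/

/-- Extreme-touch two-point event: the boundary vertices `(u,0)`, `(v,0)` are joined inside `ℤ×ℕ`
and their common cluster touches the boundary row only inside `[u,v]` (two boundary two-arm points,
`h = 1` each; amplitude-free: it is the number density of clusters by touch-extremes). -/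
def extremeTouch (u v : ℤ) : Set (BondConfig (Site 2)) :=
  openConnIn UHP ![u, 0] ![v, 0] \ openCrossing UHP {![u, 0]} {w | w 1 = 0 ∧ (w 0 < u ∨ v < w 0)}

/-- `T₂(u,v) = P_{1/2}(extremeTouch u v)`. -/
def T2 (u v : ℤ) : ℝ := P.real (extremeTouch u v)

/-- Two-point touch law at the KNOWN exponent `2 = 2·β₂⁺`: `m² T₂(0,m) → K₂ > 0` (RSW gives
`T₂(0,m) ≍ m⁻²`; the content is the existence of the constant). -/
def TwoPointTouchLaw : Prop :=
  ∃ K₂ : ℝ, 0 < K₂ ∧ Tendsto (fun m : ℕ ↦ (m : ℝ) ^ 2 * T2 0 m) atTop (nhds K₂)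

/-- Amplitude-free KSZ-type factorisation of the touch probability (all powers of `n` cancel):
`P(E)³ · √(T₂(a,b)T₂(b,c)T₂(a,c)) / (T₂(a,x)T₂(b,x)T₂(c,x)) → K_u`, one universal constant for ALL
shapes `a<b<c<x`. Cardy ⇒ this with `K_u = (cardyConst/3)³/K₂^{3/2}`; conversely see
`ShapeFromFactorisation`. -/
def FactorisedTouchRatio : Prop :=
  ∃ Ku : ℝ, 0 < Ku ∧ ∀ a b c x : ℝ, a < b → b < c → c < x →
    Tendsto (fun n : ℕ ↦
      touchProb ⌊a * n⌋ ⌊b * n⌋ ⌊c * n⌋ ⌊x * n⌋ ^ 3 *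
        Real.sqrt (T2 ⌊a * n⌋ ⌊b * n⌋ * T2 ⌊b * n⌋ ⌊c * n⌋ * T2 ⌊a * n⌋ ⌊c * n⌋) /
          (T2 ⌊a * n⌋ ⌊x * n⌋ * T2 ⌊b * n⌋ ⌊x * n⌋ * T2 ⌊c * n⌋ ⌊x * n⌋)) atTop (nhds Ku)


/-- Pairwise separability (screening-freeness) of the touch law, T₂-free form: the double ratio in the
two source-arc ends converges to a cube root of a cross-ratio of `a, a', b, b'` and does NOT depend on
`c` or `x` (the far marks are screened out). A consequence of the pure-product form; its qualitative
half (independence of `c`, `x`) is exponent-free. -/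
def DoubleRatioLaw : Prop :=
  ∀ a a' b b' c x : ℝ, a < a' → a' < b → b < b' → b' < c → c < x →
    Tendsto (fun n : ℕ ↦
      touchProb ⌊a * n⌋ ⌊b * n⌋ ⌊c * n⌋ ⌊x * n⌋ * touchProb ⌊a' * n⌋ ⌊b' * n⌋ ⌊c * n⌋ ⌊x * n⌋ /
        (touchProb ⌊a' * n⌋ ⌊b * n⌋ ⌊c * n⌋ ⌊x * n⌋ * touchProb ⌊a * n⌋ ⌊b' * n⌋ ⌊c * n⌋ ⌊x * n⌋))
      atTop (nhds ((((b - a) * (b' - a')) / ((b - a') * (b' - a))) ^ (1 / 3 : ℝ)))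

/-- The crux implies the double-ratio law (algebra of limits; provable now). -/
def DoubleRatioOfCrux : Prop := HalfPlaneMarkDensityLaw → DoubleRatioLaw

/-- Pure algebra of limits (with translation invariance `T₂(u,v) = T₂(0,v-u)`): the two laws give the
pure-product SHAPE of the touch density with an undetermined constant `K' = (K_u K₂^{3/2})^{1/3}`;
the exponent `1/3` is an OUTPUT (cube root of `β₂⁺ = 1`). Provable now. -/
def ShapeFromFactorisation : Prop :=
  TwoPointTouchLaw → FactorisedTouchRatio →
    ∃ K' : ℝ, 0 < K' ∧ ∀ a b c x : ℝ, a < b → b < c → c < x →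
      Tendsto (fun n : ℕ ↦ (n : ℝ) * touchProb ⌊a * n⌋ ⌊b * n⌋ ⌊c * n⌋ ⌊x * n⌋) atTop
        (nhds (K' * ((b - a) * (c - b) * (c - a)) ^ (1 / 3 : ℝ) *
          ((x - a) * (x - b) * (x - c)) ^ (-(2 / 3) : ℝ)))

/-- Normalisation forces the constant (no free constant in the crux): window sums are crossing
probabilities (`WindowTelescoping`), RSW domination makes `∑ₖ P(E(k))` converge to `∫ K'·shape`
(`= K'·(3/cardyConst)·F((b-a)/(c-a))` by the calculus of `PureProductIntegrates`), and
`P[[an,bn] ↔ [cn,∞)] → 1` as `c ↓ b` (RSW: a closed dual arm from a vanishing gap) with `F(1) = 1`. -/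
def ConstantForced : Prop :=
  ∀ K' : ℝ, 0 < K' →
    (∀ a b c x : ℝ, a < b → b < c → c < x →
      Tendsto (fun n : ℕ ↦ (n : ℝ) * touchProb ⌊a * n⌋ ⌊b * n⌋ ⌊c * n⌋ ⌊x * n⌋) atTop
        (nhds (K' * ((b - a) * (c - b) * (c - a)) ^ (1 / 3 : ℝ) *
          ((x - a) * (x - b) * (x - c)) ^ (-(2 / 3) : ℝ)))) →
    K' = cardyConst / 3

/-- Composition of the factorisation line (kernel-checked shape of the future skeleton). -/
theorem line_of (hS : ShapeFromFactorisation) (hC : ConstantForced)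
    (hT : TwoPointTouchLaw) (hR : FactorisedTouchRatio) : HalfPlaneMarkDensityLaw := by
  obtain ⟨K', hK', hshape⟩ := hS hT hR
  have hK : K' = cardyConst / 3 := hC K' hK' hshape
  subst hK
  exact hshape

/-- Composition of the de-localisation line through the sibling crux. -/
theorem crux_of_rectilinear (hW : WindowToPointwise) (hB : BoxExhaustion)
    (hE : ShiftRatioEquicontinuity) (h4 : RectilinearCardy) : HalfPlaneMarkDensityLaw :=
  hW (hB h4) hE

end

end Summit.CriticalPhenomena.CardyFormulaZ2.Cruxes.HalfPlaneMarkDensityLaw.SketchIdeator1
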